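import Summits.QuantumFields.QCD.Theorems.WilsonMobilityGapMobilityGapStubLightMoment

/-!
# Crux `MobilityGap` (stmt-QuantumFields-9150) — line `Sketch` with FREE DATA: definitions

Reshape 3 of line `Sketch` (lead seat prover-line-stmt-QuantumFields-9150-c2-0, 2026-08-16).  The pinned line
(`…SketchDefs.lean`, `…SketchReduction.lean`) hard-wires the data `a_k = e^{-(k+1)}`, `β_k = afBeta N_f 1 a_k`,
certificate exponent `½`; its infrared stub `stub_lightMoment` is therefore a light-moment law AT THOSE COUPLINGS,
which no item of the pool implies (dedup, `…StubLightMoment.lean` §4): every item carrying a phase-quenched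
propagator-moment lower bound does so along its own `∃ reg`.  Here the whole threshold construction is run on
ARBITRARY admissible data `d : LineData N_f` — spacings `a_k → 0`, couplings on the two-loop profile for some
`Λ`, an exponent `s ∈ (0,1)` — so that the infrared input of the line becomes exactly
`LightMomentFree N_f` (landed), which is NECESSARY for the crux (`lightMomentFree_of_mobilityGap`, landed) and is
implied by the sibling crux `PauliWegnerSea.OneScaleTrajectory` (`lightMomentFree_of_oneScaleTrajectory`, landed).
The two remaining laws (clause (iii) in the window above the threshold; extinction of deep real-mode crossers at
the scheme's volume) are asked at every admissible datum that carries a light moment — trajectory-universal, as a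
law of the interacting measure should be.

§1 data · §2 derived data (`Z_m`, slow scale `ℓ`, slab, volume floor) and elementary facts · §3 the threshold of clause (ii) at
exponent `d.s` · §4 the witness regularisation · §5 the laws (`BadFloorAt`, `LowerAt`, `ExtinctAt`, `SignAt`,
`LawLightFree`, `LawLowerFree`, `LawExtinctFree`).  The glue and the composition are in `…SketchFreeReduction.lean`.
-/

noncomputable section

namespace Summit.QuantumFields.QCD.Theorems.MobilityGapSketch

open scoped BigOperators Topology
open MeasureTheory Filter Set
open Literature.MathematicalPhysics.QuantumFieldTheory Literature.MathematicalPhysics.QuantumLattice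
  Literature.Probability.LatticeModels

/-! ### §1 Admissible line data -/

/-- **Admissible data of the threshold line**: lattice spacings `a_k > 0`, `a_k → 0`; inverse bare couplings
`β_k` (tree normalisation `β = 2/g₀²`) on the two-loop asymptotic-freedom profile for SOME lattice
`Λ`-parameter (`β_k - afBeta N_f Λ a_k → 0`, the body of `QCDScheme.HasAsymptoticScaling`); and the exponent
`s ∈ (0,1)` at which the clause-(ii) certificate is issued.  Exactly the data of `LightMomentFree N_f`. -/
structure LineData (Nf : ℕ) where
  /-- lattice spacings -/
  a : ℕ → ℝ
  a_pos : ∀ k, 0 < a k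
  tendsto_a : Tendsto a atTop (𝓝 0)
  /-- inverse bare couplings, tree normalisation -/
  β : ℕ → ℝ
  scaling : ∃ Λ > (0 : ℝ), Tendsto (fun k => β k - afBeta Nf Λ (a k)) atTop (𝓝 0)
  /-- certificate exponent -/
  s : ℝ
  s_pos : 0 < s
  s_lt_one : s < 1

namespace LineData

variable {Nf : ℕ} (d : LineData Nf)

variable (Nf) in
/-- Non-vacuity: the pinned data of the original line (`a_k = e^{-(k+1)}`, `β_k = afBeta N_f 1 a_k`, exponent `½`) are
admissible. -/
def pinned : LineData Nf where
  a := aSeq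
  a_pos := aSeq_pos
  tendsto_a := tendsto_aSeq
  β := betaSeq Nf
  scaling := ⟨1, one_pos, tendsto_const_nhds.congr' (Eventually.of_forall fun k => by
    show (0 : ℝ) = betaSeq Nf k - afBeta Nf 1 (aSeq k); rw [betaSeq, sub_self])⟩
  s := 1 / 2
  s_pos := by norm_num
  s_lt_one := by norm_num

/-! ### §2 Derived data and elementary facts -/

/-- The canonical mass renormalisation along the data: `Z_m(k) := max(1, log a_k⁻²)^{γ₀/(2β₀)}`
(`= (log a_k⁻²)^{γ₀/(2β₀)}` as soon as `a_k ≤ e^{-1/2}`): leading-log mass scaling by fiat. -/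
def zm (k : ℕ) : ℝ := (max 1 (Real.log (1 / d.a k ^ 2))) ^ massExponent Nf

/-- The slow scale `ℓ_k := log(2 + |log a_k|)` of the data (`≥ log 2 > 0`, `→ ∞`, doubly logarithmic in the cutoff):
the physical side of the volume floor and the renormalised width of the slab.  Tied to `a_k`, never to the index `k`,
so that every law along the data is a statement about the cutoff alone (any positive power of `a_k` beats `ℓ_k⁴`). -/
def ell (k : ℕ) : ℝ := Real.log (2 + |Real.log (d.a k)|)

/-- Slab width `w_k := ℓ_k · a_k / Z_m(k)` (admissible bare spread of the certified tuples; it dominates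
`a_k · max|m_f - m_g| / Z_m(k)` eventually for every fixed tuple `m`). -/
def slab (k : ℕ) : ℝ := d.ell k * d.a k / d.zm k

/-- Volume floor `L⁰_k := ⌈ℓ_k/a_k⌉`: certificates are demanded on all tori `S ≥ L⁰_k` (physical side `≥ 2ℓ_k → ∞`). -/
def vfloor (k : ℕ) : ℕ := ⌈d.ell k / d.a k⌉₊

/-- `ℓ_k ≥ log 2 > 0`. -/
theorem ell_pos (k : ℕ) : 0 < d.ell k :=
  Real.log_pos (by have := abs_nonneg (Real.log (d.a k)); linarith)

/-- `ℓ_k → ∞`. -/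
theorem tendsto_ell : Tendsto d.ell atTop atTop := by
  have h0 : Tendsto d.a atTop (𝓝[>] 0) :=
    tendsto_nhdsWithin_iff.2 ⟨d.tendsto_a, Eventually.of_forall fun k => d.a_pos k⟩
  have h1 : Tendsto (fun k => |Real.log (d.a k)|) atTop atTop :=
    tendsto_abs_atBot_atTop.comp (Real.tendsto_log_nhdsGT_zero.comp h0)
  exact Real.tendsto_log_atTop.comp (tendsto_atTop_add_const_left _ 2 h1)

/-- `Z_m(k) > 0`. -/
theorem zm_pos (k : ℕ) : 0 < d.zm k :=
  Real.rpow_pos_of_pos (lt_of_lt_of_le one_pos (le_max_left _ _)) _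

/-- `w_k ≥ 0`. -/
theorem slab_nonneg (k : ℕ) : 0 ≤ d.slab k :=
  div_nonneg (mul_nonneg (d.ell_pos k).le (d.a_pos k).le) (d.zm_pos k).le

/-- `ℓ_k ≤ a_k L⁰_k`. -/
theorem ell_le_a_mul_vfloor (k : ℕ) : d.ell k ≤ d.a k * (d.vfloor k : ℝ) := by
  have ha := d.a_pos k
  have h := Nat.le_ceil (d.ell k / d.a k)
  unfold vfloor
  calc d.ell k = d.a k * (d.ell k / d.a k) := by field_simp
    _ ≤ d.a k * (⌈d.ell k / d.a k⌉₊ : ℝ) := mul_le_mul_of_nonneg_left h ha.le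

/-- The volume floor is admissible: `a_k L⁰_k → ∞`. -/
theorem tendsto_a_mul_vfloor : Tendsto (fun k => d.a k * (d.vfloor k : ℝ)) atTop atTop :=
  tendsto_atTop_mono d.ell_le_a_mul_vfloor d.tendsto_ell

/-- `log a_k⁻² → ∞` along admissible data. -/
theorem tendsto_log_inv_sq : Tendsto (fun k => Real.log (1 / d.a k ^ 2)) atTop atTop := by
  have h0 : Tendsto (fun k => d.a k ^ 2) atTop (𝓝[>] 0) := by
    refine tendsto_nhdsWithin_iff.2 ⟨?_, Eventually.of_forall fun k => pow_pos (d.a_pos k) 2⟩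
    simpa using d.tendsto_a.pow 2
  have h1 : Tendsto (fun k => (d.a k ^ 2)⁻¹) atTop atTop := h0.inv_tendsto_nhdsGT_zero
  refine Real.tendsto_log_atTop.comp (h1.congr fun k => ?_)
  rw [one_div]

/-- Eventually `Z_m(k) = (log a_k⁻²)^{γ₀/(2β₀)}` (the `max` is inactive). -/
theorem eventually_zm_eq :
    ∀ᶠ k in atTop, d.zm k = Real.log (1 / d.a k ^ 2) ^ massExponent Nf := by
  filter_upwards [d.tendsto_log_inv_sq.eventually_ge_atTop 1] with k hk
  rw [zm, max_eq_right hk]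

end LineData

/-! ### §3 The threshold of clause (ii) along the data `d` (exponent `d.s`) -/

variable {Nf : ℕ}

/-- `CertifiedD d δ k t`: the bare tuple `t` obeys the (ii)-SHAPE BOUND with exponent `d.s`, amplitude `e^{δ}`
and physical rate `δ` at coupling `β_k`, on every torus `S ≥ L⁰_k`, for every flavour and every site of the box. -/
def CertifiedD (d : LineData Nf) (δ : ℝ) (k : ℕ) (t : Fin Nf → ℝ) : Prop :=
  ∀ S : ℕ, d.vfloor k ≤ S → ∀ (f : Fin Nf) (v : Literature.Probability.LatticeModels.Site 4), v ∈ box 4 S →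
    fm Nf (d.β k) t S f v d.s ≤ Real.exp δ * Real.exp (-(δ * (d.a k * ‖v‖)))

/-- `IsGoodFloorD d δ k u`: every bare tuple with all components `≥ u` and spread `≤ w_k` is certified. -/
def IsGoodFloorD (d : LineData Nf) (δ : ℝ) (k : ℕ) (u : ℝ) : Prop :=
  ∀ t : Fin Nf → ℝ, (∀ f, u ≤ t f) → (∀ f g, |t f - t g| ≤ d.slab k) → CertifiedD d δ k t

/-- The set of good floors on the physical branch `u ≥ -1`. -/
def floorSetD (d : LineData Nf) (δ : ℝ) (k : ℕ) : Set ℝ := {u | -1 ≤ u ∧ IsGoodFloorD d δ k u}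

/-- THE THRESHOLD `m_crit(k) := inf {u ≥ -1 | IsGoodFloorD d δ k u}` along the data `d`. -/
def thrD (d : LineData Nf) (δ : ℝ) (k : ℕ) : ℝ := sInf (floorSetD d δ k)

/-- Good floors form an up-set. -/
theorem isGoodFloorD_mono {d : LineData Nf} {δ : ℝ} {k : ℕ} {u u' : ℝ} (h : u ≤ u')
    (hu : IsGoodFloorD d δ k u) : IsGoodFloorD d δ k u' :=
  fun t ht hsp => hu t (fun f => h.trans (ht f)) hsp

/-- The floor set is bounded below by `-1`. -/
theorem floorSetD_bddBelow (d : LineData Nf) (δ : ℝ) (k : ℕ) : BddBelow (floorSetD d δ k) :=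
  ⟨-1, fun _ hu => hu.1⟩

/-- Clause (i) at the threshold: `-1 ≤ m_crit(k)` as soon as some floor is good. -/
theorem neg_one_le_thrD {d : LineData Nf} {δ : ℝ} {k : ℕ} (hne : (floorSetD d δ k).Nonempty) :
    -1 ≤ thrD d δ k :=
  le_csInf hne fun _ hu => hu.1

/-- A good floor bounds the threshold from above. -/
theorem thrD_le_of_mem {d : LineData Nf} {δ : ℝ} {k : ℕ} {u : ℝ} (hu : u ∈ floorSetD d δ k) :
    thrD d δ k ≤ u :=
  csInf_le (floorSetD_bddBelow d δ k) hu

/-- A bad floor bounds the threshold from below (up-set). -/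
theorem le_thrD_of_not_isGoodFloorD {d : LineData Nf} {δ : ℝ} {k : ℕ}
    (hne : (floorSetD d δ k).Nonempty) {x : ℝ} (hx : ¬ IsGoodFloorD d δ k x) : x ≤ thrD d δ k := by
  refine le_csInf hne fun u hu => ?_
  by_contra h
  exact hx (isGoodFloorD_mono (not_le.mp h).le hu.2)

/-- THE LEVER (order logic): a near-degenerate tuple all of whose components lie strictly above the threshold is
certified — it lies above a good floor. -/
theorem certifiedD_of_thrD_lt {d : LineData Nf} {δ : ℝ} {k : ℕ}
    (hne : (floorSetD d δ k).Nonempty) {t : Fin Nf → ℝ} (ht : ∀ f, thrD d δ k < t f)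
    (hsp : ∀ f g, |t f - t g| ≤ d.slab k) : CertifiedD d δ k t := by
  classical
  rcases isEmpty_or_nonempty (Fin Nf) with hE | hN
  · intro S _ f
    exact (IsEmpty.false f).elim
  · obtain ⟨f₀, hf₀⟩ := Finite.exists_min t
    obtain ⟨u, hu, hut⟩ := exists_lt_of_csInf_lt hne (ht f₀)
    exact hu.2 t (fun f => hut.le.trans (hf₀ f)) hsp

/-! ### §4 The witness regularisation along the data -/

/-- THE THRESHOLD WITNESS along `d`: `(a_k, β_k, L_k, m_crit := thrD d δ, Z_m)`; the volume sequence `L` is a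
parameter (chosen later by the extinction law). -/
def thrRegD (d : LineData Nf) (L : ℕ → ℕ) (hL : Tendsto (fun k => d.a k * (L k : ℝ)) atTop atTop) (δ : ℝ) :
    QCDRegularisation Nf where
  a := d.a
  a_pos := d.a_pos
  tendsto_a := d.tendsto_a
  β := d.β
  L := L
  tendsto_L := hL
  mcrit := thrD d δ
  Zm := d.zm
  Zm_pos := d.zm_pos

/-- Mass scaling of the witness (`Z_m(k)/(log a_k⁻²)^{γ₀/2β₀} = 1` eventually). -/
theorem thrRegD_hasMassScaling (d : LineData Nf) (L : ℕ → ℕ)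
    (hL : Tendsto (fun k => d.a k * (L k : ℝ)) atTop atTop) (δ : ℝ) :
    (thrRegD d L hL δ).HasMassScaling := by
  refine ⟨1, one_pos, tendsto_const_nhds.congr' ?_⟩
  filter_upwards [d.eventually_zm_eq, d.tendsto_log_inv_sq.eventually_ge_atTop 1] with k hk hk1
  show (1 : ℝ) = d.zm k / Real.log (1 / d.a k ^ 2) ^ massExponent Nf
  rw [hk, div_self (Real.rpow_pos_of_pos (by linarith) _).ne']

/-- Asymptotic scaling of the witness (the data's own two-loop profile). -/
theorem thrRegD_hasAsymptoticScaling (d : LineData Nf) (L : ℕ → ℕ)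
    (hL : Tendsto (fun k => d.a k * (L k : ℝ)) atTop atTop) (δ : ℝ) :
    ((thrRegD d L hL δ).scheme 0 0 0).HasAsymptoticScaling :=
  d.scaling

/-! ### §5 The laws along the data, and the three free laws -/

/-- COMPOSITION INPUT 1 at `d`: for every large rate `δ`, eventually in `k`, some bare mass `x > -1` is a BAD
floor of the (ii)-certificate along `d` (a theorem of a light `d.s`-moment along `(d.a, d.β)`). -/
def BadFloorAt (d : LineData Nf) : Prop :=
  ∀ᶠ δ in atTop, ∀ᶠ k in atTop, ∃ x : ℝ, -1 < x ∧ ¬ IsGoodFloorD d δ k x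

/-- LAW 2 at `d` = clause (iii) in the renormalised window above the threshold along `d`: for every large `δ`
and every `M > 0` there are `s ∈ (0,1)`, `c₀ > 0`, `C₁`, `p` with
`c₀ e^{-C₁ a_k n}(n+1)^{-p} ≤ E_{|w|,β_k,S,t}[(Σ|G_f(0,n e₀)|)^s]` for all large `k`, all window tuples
`t ∈ (m_crit(k), m_crit(k) + a_k M/Z_m(k)]^{N_f}`, all `S ≥ L⁰_k`, `f`, `n ≤ S`. -/
def LowerAt (d : LineData Nf) : Prop :=
  ∀ᶠ δ in atTop, ∀ M : ℝ, 0 < M → ∃ s c₀ C₁ p : ℝ, 0 < s ∧ s < 1 ∧ 0 < c₀ ∧ ∀ᶠ k in atTop,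
    (floorSetD d δ k).Nonempty → -1 < thrD d δ k → ∀ t : Fin Nf → ℝ,
      (∀ f, thrD d δ k < t f) → (∀ f, t f ≤ thrD d δ k + d.a k * M / d.zm k) →
        ∀ S : ℕ, d.vfloor k ≤ S → ∀ (f : Fin Nf) (n : ℕ), n ≤ S →
          c₀ * Real.exp (-(C₁ * (d.a k * n) + p * Real.log (n + 1))) ≤
            fm Nf (d.β k) t S f (Pi.single 0 (n : ℤ)) s

/-- LAW 3 at `d` = DEEP REAL-MODE CROSSERS ARE EXTINCT AT THE SCHEME'S OWN VOLUME along `d`: there is an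
admissible volume sequence `L ≥ L⁰` (eventually) such that for every large `δ`, every `M > 0`, eventually in `k`,
for every window tuple `t` the phase-quenched expected number `Σ_f #{real eigenvalues of D_W(U,0,1) below −t_f}`
on the torus of side `2L_k+1` at coupling `β_k` is `≤ 1/4`. -/
def ExtinctAt (d : LineData Nf) : Prop :=
  ∃ L : ℕ → ℕ, Tendsto (fun k => d.a k * (L k : ℝ)) atTop atTop ∧ (∀ᶠ k in atTop, d.vfloor k ≤ L k) ∧
    ∀ᶠ δ in atTop, ∀ M : ℝ, 0 < M → ∀ᶠ k in atTop,
      (floorSetD d δ k).Nonempty → -1 < thrD d δ k → ∀ t : Fin Nf → ℝ,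
        (∀ f, thrD d δ k < t f) → (∀ f, t f ≤ thrD d δ k + d.a k * M / d.zm k) →
          (∫ U : GaugeConfig 4 (2 * L k + 1) (Matrix.specialUnitaryGroup (Fin 3) ℂ),
              (∑ f : Fin Nf, (Multiset.countP (fun z : ℂ => z.im = 0 ∧ z.re < -t f)
                (wilsonDirac (fundamentalRep (Fin 3)) U 0 1).charpoly.roots : ℝ)) *
                ∏ f : Fin Nf, ‖fermionDet (wilsonDirac (fundamentalRep (Fin 3)) U (t f) 1)‖
              ∂(wilsonMeasure (d := 4) (L := 2 * L k + 1) (fundamentalRep (Fin 3)) (d.β k))) /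
            (∫ U : GaugeConfig 4 (2 * L k + 1) (Matrix.specialUnitaryGroup (Fin 3) ℂ),
              ∏ f : Fin Nf, ‖fermionDet (wilsonDirac (fundamentalRep (Fin 3)) U (t f) 1)‖
              ∂(wilsonMeasure (d := 4) (L := 2 * L k + 1) (fundamentalRep (Fin 3)) (d.β k))) ≤ 1 / 4

/-- COMPOSITION INPUT 3 at `d`: clause (iv) in the window on some admissible volume sequence above the floor
(a theorem of `ExtinctAt d` by the landed `PositivityDeficitLeDefects`). -/
def SignAt (d : LineData Nf) : Prop :=
  ∃ L : ℕ → ℕ, Tendsto (fun k => d.a k * (L k : ℝ)) atTop atTop ∧ (∀ᶠ k in atTop, d.vfloor k ≤ L k) ∧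
    ∀ᶠ δ in atTop, ∀ M : ℝ, 0 < M → ∀ᶠ k in atTop,
      (floorSetD d δ k).Nonempty → -1 < thrD d δ k → ∀ t : Fin Nf → ℝ,
        (∀ f, thrD d δ k < t f) → (∀ f, t f ≤ thrD d δ k + d.a k * M / d.zm k) →
          (1 / 2 : ℝ) ≤
            ‖∫ U : GaugeConfig 4 (2 * L k + 1) (Matrix.specialUnitaryGroup (Fin 3) ℂ),
                (diracMatrix U t).det ∂(wilsonMeasure (fundamentalRep (Fin 3)) (d.β k))‖ /
              (∫ U : GaugeConfig 4 (2 * L k + 1) (Matrix.specialUnitaryGroup (Fin 3) ℂ),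
                ‖(diracMatrix U t).det‖ ∂(wilsonMeasure (fundamentalRep (Fin 3)) (d.β k)))

/-- LAW 1 (infrared, FREE currency; registered stub `stub_lightFree`): for `N_f ∈ {2,3}` SOME admissible data and
SOME exponent carry a light moment above bare mass `-1` — `LightMomentFree N_f` (landed; necessary for the crux by
`lightMomentFree_of_mobilityGap`, implied by `PauliWegnerSea.OneScaleTrajectory`). -/
def LawLightFree : Prop :=
  ∀ Nf : ℕ, Nf = 2 ∨ Nf = 3 → LightMomentFree Nf

/-- LAW 2 (registered stub `stub_lowerAt`, folded): clause (iii) above the threshold along EVERY admissible datum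
that carries a light moment at its own exponent. -/
def LawLowerFree : Prop :=
  ∀ Nf : ℕ, Nf = 2 ∨ Nf = 3 → ∀ d : LineData Nf, LightMomentAt Nf d.a d.β d.s → LowerAt d

/-- LAW 3 (registered stub `stub_extinctAt`, folded): extinction of deep crossers at the scheme's volume along EVERY
admissible datum that carries a light moment at its own exponent. -/
def LawExtinctFree : Prop :=
  ∀ Nf : ℕ, Nf = 2 ∨ Nf = 3 → ∀ d : LineData Nf, LightMomentAt Nf d.a d.β d.s → ExtinctAt d

/-- Packing the data of a free light moment. -/
theorem exists_lineData_of_lightMomentFree (h : LightMomentFree Nf) :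
    ∃ d : LineData Nf, LightMomentAt Nf d.a d.β d.s := by
  obtain ⟨a, β, ha, hta, hsc, s, hs, hs1, hl⟩ := h
  exact ⟨⟨a, ha, hta, β, hsc, s, hs, hs1⟩, hl⟩

/-- Registry anchor (vacuous `N_f = 0` slice of the threshold logic along any datum): with no flavours every tuple
is certified, so every floor `u ≥ -1` is good and the threshold is `-1`. [folklore] -/
theorem thrD_nf_zero : ∀ (d : LineData 0) (δ : ℝ) (k : ℕ), thrD d δ k = -1 := by
  intro d δ k
  have hgood : ∀ u : ℝ, IsGoodFloorD d δ k u := fun u t _ _ S _ f => (IsEmpty.false f).elim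
  have hset : floorSetD d δ k = Set.Ici (-1) := by
    ext u
    exact ⟨fun hu => hu.1, fun hu => ⟨hu, hgood u⟩⟩
  rw [thrD, hset, csInf_Ici]

end Summit.QuantumFields.QCD.Theorems.MobilityGapSketch

end
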